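import Mathlib
import Summits.Ventures.PercRepro2.HCov
import Summits.Ventures.PercRepro2.HCovCubic
import Summits.Ventures.PercRepro2.HCovTyped
import Summits.Ventures.PercRepro2.TriDisagreement
import Summits.Ventures.PercRepro2.TriDisagreementPinned
import Summits.Ventures.PercRepro2.RECMReduction
import Summits.Ventures.PercRepro2.RECMReductionC
import Summits.Ventures.PercRepro2.GcTransport
import Summits.Ventures.PercRepro2.CCWReduction
import Summits.Ventures.PercRepro2.CCWTyped
import Summits.Ventures.PercRepro2.GcTransportMarks
import Summits.Ventures.PercRepro2.GcSeries
import Summits.Ventures.PercRepro2.GcParallel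
import Summits.Ventures.PercRepro2.CCWReduced

/-!
# The (root) residual map of record, typed, on the reduced class of simple graphs (blind cell
PercRepro2, p1 g11)

`CCWReduced.lean` needs (c-CW) in weighted form only on SIMPLE graphs at root edges `e = {a₁, y}`
whose unmarked end has degree ≥ 3; `CCWTyped.lean` derives the weighted (c-CW) at an edge from the
typed one at that edge. Putting the two together:

* **`cCWRedSTyped_all c`**: the typed row (c-CW) — `N_{(k′,j)} ≥ c · N_{(k′,3)}`, `j = 1, 2`, on every
  minor — at every root edge of every SIMPLE finite graph whose unmarked end has degree ≥ 3 (the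
  reduced class of the census lists, LEAD-CCW §3⁗ / ASSIGNMENTS v12.17);
* **`HCov_all_of_cCWRedSTyped_all`**: `0 ≤ c → cCWRedSTyped_all c → HCovR_all → HCov_all`;
* **`HCov_all_of_cCWRedSTyped_all_of_typedBasesR`**: `0 ≤ c → cCWRedSTyped_all c →
  TypedBasesR_all → HCov_all` — the crux `CovForm.HCov_all` from the typed (c-CW) on the reduced
  class of simple graphs and row 2′TRI on class R (the cell's paper theorem, night-3 g2).
-/

namespace Summit.Ventures.PercRepro2

open CovForm Contract

namespace RECM

section Closure

variable (R : Type*) [Field R] [LinearOrder R] [IsStrictOrderedRing R]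

/-- **Row (c-CW), typed, on the reduced class of simple graphs**. -/
def cCWRedSTyped_all (c : R) : Prop :=
  ∀ (V E : Type) [Fintype V] [DecidableEq V] [Fintype E] [DecidableEq E] (ends : E → Sym2 V),
    Simple ends → ∀ o a₁ a₂ a₃ b : V, a₁ ≠ a₂ → a₁ ≠ a₃ → a₂ ≠ a₃ → o ≠ a₁ → o ≠ a₂ → o ≠ a₃ →
      o ≠ b → b ≠ a₁ → b ≠ a₂ → b ≠ a₃ → ∀ (y : V) (e : E), Unmarked o a₁ a₂ a₃ b y →
        ends e = s(a₁, y) → 2 ≤ (otherEdges ends e y).card → cCWTypedAt c ends o a₁ a₂ a₃ b e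

variable {R}

/-- Typed (c-CW) on the reduced class of simple graphs gives the weighted one. -/
theorem cCWRedS_all_of_typed {c : R} (hT : cCWRedSTyped_all R c) : cCWRedS_all R c := by
  intro V E _ _ _ _ ends hs p hp o a₁ a₂ a₃ b h12 h13 h23 ho1 ho2 ho3 hob hb1 hb2 hb3 y e hy he hd
  exact cCWAt_of_typed p hp he hy ho1 h12 h13 hb1
    (hT V E ends hs o a₁ a₂ a₃ b h12 h13 h23 ho1 ho2 ho3 hob hb1 hb2 hb3 y e hy he hd)

omit [IsStrictOrderedRing R] in
/-- Typed (c-CW) everywhere gives typed (c-CW) on the reduced class of simple graphs. -/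
theorem cCWRedSTyped_all_of_cCWTyped_all {c : R} (h : cCWTyped_all R c) : cCWRedSTyped_all R c :=
  fun V E _ _ _ _ ends _ o a₁ a₂ a₃ b h12 h13 h23 ho1 ho2 ho3 hob hb1 hb2 hb3 y e hy he _ =>
    h V E ends o a₁ a₂ a₃ b h12 h13 h23 ho1 ho2 ho3 hob hb1 hb2 hb3 y e hy he

/-- **THE (root) RESIDUAL MAP, TYPED, ON THE REDUCED CLASS OF SIMPLE GRAPHS**:
`0 ≤ c → cCWRedSTyped_all c → HCovR_all → HCov_all`. -/
theorem HCov_all_of_cCWRedSTyped_all {c : R} (hc : 0 ≤ c) (hT : cCWRedSTyped_all R c)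
    (hB : HCovR_all R) : HCov_all R :=
  HCov_all_of_cCWRedS_all hc (cCWRedS_all_of_typed hT) hB

/-- **The crux from the typed (c-CW) on the reduced class and 2′TRI on class R**:
`0 ≤ c → cCWRedSTyped_all c → TypedBasesR_all → HCov_all`. -/
theorem HCov_all_of_cCWRedSTyped_all_of_typedBasesR {c : R} (hc : 0 ≤ c)
    (hT : cCWRedSTyped_all R c) (hR : TypedBasesR_all R) : HCov_all R :=
  HCov_all_of_cCWRedSTyped_all hc hT (HCovR_all_of_typedBasesR hR)

end Closure

end RECM

end Summit.Ventures.PercRepro2
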